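import Summits.HubbardSuperconductivity.HubbardLadder.Bounds.FdcBlockProductOperators
import Literature.MathematicalPhysics.QuantumLattice.HeisenbergClusterProductUpperBound
import HarnessLib

/-!
# The sheared 2×2 two-tiling of the torus `(ℤ/2kℤ)²`: clusters and dual plaquettes

HONEST FRAMING: ladder R1–R4 with certified numbers; no claim on H/H₀; bounds for model classes,
no materials claim.

Geometry and light-cone operator algebra for finite-depth-circuit (FDC) trial states
`Ψ = U Ψ₀` on the spin torus `(ℤ/Lℤ)²`, `L = 2k`:
* `Ψ₀ = ⨂_{clusters} φ` is a product over the `k²` CLUSTERS `{2c, 2c+1}²` — the box-block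
  decomposition `fdcEA : (ℤ/Lℤ)² ≃ A × P`, `A = (ℤ/kℤ)²` (cluster labels), `P = (ℤ/2ℤ)²`
  (positions = coordinate parities);
* `U = ⨂_{plaquettes} u` is a product of one unitary `u` per DUAL PLAQUETTE `{2b-1, 2b}²` — the
  SHEARED decomposition `fdcEB := fdcEA.trans (shear)`, `(c, δ) ↦ (c + ι δ, δ)` with
  `ι δ = (δ₀.val, δ₁.val)`: plaquette `b` consists of the corners `δ` of the clusters `b - ι δ`.
We record: the corner description `fdcEA (blockEmb fdcEB b δ) = (b - ι δ, δ)`; the arithmetic of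
`ι` (`ι` is injective, and `ι δ'' = ι δ' + eᵢ` forces `δ'_i = 0`, `δ'' = δ' + eᵢ`, for `k ≥ 3`);
the classification of the bond `(x, x + eᵢ)` by the parity `δ_i` of `x` (an intra-cluster
"A-bond" meets two plaquettes `b, b + eᵢ`; a seam "B-bond" lies inside one plaquette); and the
conjugation rules `U† (onSite x s) U = spinEmbed_b (u† s_δ u)`.
References: block-product / tensor-network trial states, Tasaki (2020) §2.2, §2.5 [cite: Tasaki2020];
Anderson (1951) (cluster variational states). [folklore]
-/

namespace Summit.HubbardSuperconductivity.HubbardLadder.Bounds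

open Matrix Finset Complex
open Literature.Probability.LatticeModels Literature.MathematicalPhysics.QuantumLattice
open Literature.MathematicalPhysics.QuantumLattice.HeisenbergTL

noncomputable section

/-! ### The two decompositions -/

section Geometry

/-- Constant box-side vector `(m, m)`. [folklore] -/
abbrev cvec (m : ℕ) : Fin 2 → ℕ := fun _ => m

/-- Cluster labels `A = (ℤ/kℤ)²`. [folklore] -/
abbrev FdcA (k : ℕ) : Type := RectTorusSite (cvec k)

/-- Positions / parities `P = (ℤ/2ℤ)²`. [folklore] -/
abbrev FdcP : Type := RectTorusSite (cvec 2)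

variable {k L : ℕ} [NeZero k]

omit [NeZero k] in
/-- `k · 2 = L` coordinatewise. [folklore] -/
theorem cvec_mul (hkL : k * 2 = L) : ∀ i : Fin 2, cvec k i * cvec 2 i = L := fun _ => hkL

/-- The CLUSTER decomposition `(ℤ/Lℤ)² ≃ A × P`, `x = 2c + δ`. [folklore] -/
def fdcEA (hkL : k * 2 = L) : TorusSite 2 L ≃ FdcA k × FdcP :=
  boxBlockDecomp L (cvec k) (cvec 2) (cvec_mul hkL)

/-- `ι : P → A`, `δ ↦ (δ₀.val, δ₁.val)` read in `(ℤ/kℤ)²`. [folklore] -/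
def fdcIota (k : ℕ) (δ : FdcP) : FdcA k := fun i => ((δ i).val : ZMod k)

/-- The shear `(c, δ) ↦ (c + ι δ, δ)` of `A × P`. [folklore] -/
def fdcShear (k : ℕ) [NeZero k] : FdcA k × FdcP ≃ FdcA k × FdcP where
  toFun p := (p.1 + fdcIota k p.2, p.2)
  invFun p := (p.1 - fdcIota k p.2, p.2)
  left_inv p := by simp
  right_inv p := by simp

/-- The PLAQUETTE decomposition `(ℤ/Lℤ)² ≃ A × P`: site `2c + δ` lies in plaquette `c + ι δ` at
position `δ`. [folklore] -/
def fdcEB (hkL : k * 2 = L) : TorusSite 2 L ≃ FdcA k × FdcP := (fdcEA hkL).trans (fdcShear k)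

/-- Unfolding of `fdcEB`: plaquette index `c + ι δ`, position `δ`. [folklore] -/
theorem fdcEB_apply (hkL : k * 2 = L) (x : TorusSite 2 L) :
    fdcEB hkL x = ((fdcEA hkL x).1 + fdcIota k (fdcEA hkL x).2, (fdcEA hkL x).2) := rfl

/-- **Corners**: position `δ` of plaquette `b` is position `δ` of cluster `b - ι δ`. [folklore] -/
theorem fdcEA_blockEmb (hkL : k * 2 = L) (b : FdcA k) (δ : FdcP) :
    fdcEA hkL (blockEmb (fdcEB hkL) b δ) = (b - fdcIota k δ, id δ) := by
  show fdcEA hkL ((fdcEA hkL).symm ((fdcShear k).symm (b, δ))) = _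
  rw [Equiv.apply_symm_apply]
  rfl

/-! ### Arithmetic of `ι` -/

omit [NeZero k] in
/-- Naturals `≤ 2` with equal casts in `ZMod k`, `k ≥ 3`, are equal. [folklore] -/
private theorem natCast_zmod_inj (hk : 3 ≤ k) {a a' : ℕ} (ha : a ≤ 2) (ha' : a' ≤ 2)
    (h : (a : ZMod k) = (a' : ZMod k)) : a = a' := by
  have h' := (ZMod.natCast_eq_natCast_iff' a a' k).1 h
  rwa [Nat.mod_eq_of_lt (by omega), Nat.mod_eq_of_lt (by omega)] at h'

/-- `z.val ≤ 1` for `z : ZMod 2`. [folklore] -/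
private theorem zmod2_val_le (z : ZMod 2) : z.val ≤ 1 := by
  have := ZMod.val_lt z
  omega

/-- Every `z : ZMod 2` is `0` or `1`. [folklore] -/
private theorem zmod2_eq_zero_or_one (z : ZMod 2) : z = 0 ∨ z = 1 := by
  revert z
  decide

/-- `1 + 1 = 0` in `ZMod 2`. [folklore] -/
private theorem zmod2_one_add_one : (1 : ZMod 2) + 1 = 0 := by decide

/-- `(1 : ZMod 2).val = 1`. [folklore] -/
private theorem zmod2_val_one : (1 : ZMod 2).val = 1 := by decide

/-- For `z = 0` in `ZMod 2`, `(z + 1).val = z.val + 1`. [folklore] -/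
private theorem zmod2_val_add_one_of_eq_zero {z : ZMod 2} (hz : z = 0) : (z + 1).val = z.val + 1 := by
  subst hz
  decide

omit [NeZero k] in
/-- `ι` commutes with `+ eᵢ` on positions whose `i`-th parity is `0`. [folklore] -/
theorem fdcIota_add_single (δ : FdcP) (i : Fin 2) (hδ : δ i = 0) :
    fdcIota k (δ + Pi.single i 1) = fdcIota k δ + Pi.single i 1 := by
  funext j
  simp only [fdcIota, Pi.add_apply]
  by_cases hj : j = i
  · subst hj
    rw [Pi.single_eq_same, Pi.single_eq_same, zmod2_val_add_one_of_eq_zero hδ, Nat.cast_succ]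
  · rw [Pi.single_eq_of_ne hj, Pi.single_eq_of_ne hj, add_zero, add_zero]

omit [NeZero k] in
/-- … and on positions whose `i`-th parity is `1`, `ι (δ + eᵢ) + eᵢ = ι δ`. [folklore] -/
theorem fdcIota_add_single_of_ne (δ : FdcP) (i : Fin 2) (hδ : δ i ≠ 0) :
    fdcIota k (δ + Pi.single i 1) + Pi.single i 1 = fdcIota k δ := by
  have h1 : (δ + Pi.single i 1 : FdcP) i = 0 := by
    rw [Pi.add_apply, Pi.single_eq_same]
    rcases zmod2_eq_zero_or_one (δ i) with h | h
    · exact absurd h hδ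
    · rw [h]; exact zmod2_one_add_one
  have h2 := fdcIota_add_single (k := k) (δ + Pi.single i 1) i h1
  have h3 : δ + Pi.single i 1 + Pi.single i 1 = δ := by
    rw [add_assoc, ← Pi.single_add, zmod2_one_add_one, Pi.single_zero, add_zero]
  rw [h3] at h2
  exact h2.symm

omit [NeZero k] in
/-- **Key rigidity** (`k ≥ 3`): `ι δ'' = ι δ' + eᵢ` forces `δ'_i = 0` and `δ'' = δ' + eᵢ`. [folklore] -/
theorem fdcIota_eq_add_single (hk : 3 ≤ k) {δ' δ'' : FdcP} {i : Fin 2}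
    (h : fdcIota k δ'' = fdcIota k δ' + Pi.single i 1) : δ' i = 0 ∧ δ'' = δ' + Pi.single i 1 := by
  have hc : ∀ j, ((δ'' j).val : ZMod k) = ((δ' j).val : ZMod k) + Pi.single (M := fun _ => ZMod k) i 1 j :=
    fun j => by simpa [fdcIota] using congrFun h j
  have hi := hc i
  rw [Pi.single_eq_same, ← Nat.cast_succ] at hi
  have hvi := natCast_zmod_inj hk (by have := zmod2_val_le (δ'' i); omega)
    (by have := zmod2_val_le (δ' i); omega) hi
  have h0 : (δ' i).val = 0 := by have := zmod2_val_le (δ'' i); omega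
  have hδ'0 : δ' i = 0 := (ZMod.val_eq_zero _).1 h0
  refine ⟨hδ'0, funext fun j => ?_⟩
  by_cases hj : j = i
  · subst hj
    apply ZMod.val_injective
    rw [hvi, Pi.add_apply, Pi.single_eq_same, zmod2_val_add_one_of_eq_zero hδ'0]
  · have hcj := hc j
    rw [Pi.single_eq_of_ne hj, add_zero] at hcj
    have := natCast_zmod_inj hk (zmod2_val_le _ |>.trans (by norm_num))
      (zmod2_val_le _ |>.trans (by norm_num)) hcj
    rw [Pi.add_apply, Pi.single_eq_of_ne hj, add_zero]
    exact ZMod.val_injective _ this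

omit [NeZero k] in
/-- `ι` is injective (`k ≥ 3`). [folklore] -/
theorem fdcIota_injective (hk : 3 ≤ k) : Function.Injective (fdcIota k) := by
  intro δ δ' h
  funext j
  have hcj : ((δ j).val : ZMod k) = ((δ' j).val : ZMod k) := by simpa [fdcIota] using congrFun h j
  exact ZMod.val_injective _ (natCast_zmod_inj hk (zmod2_val_le _ |>.trans (by norm_num))
    (zmod2_val_le _ |>.trans (by norm_num)) hcj)

omit [NeZero k] in
/-- **Corner clusters**: corner `δ` of plaquette `b` lies in cluster `fdcCorner k b δ = b - ι δ`.
[folklore] -/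
def fdcCorner (k : ℕ) (b : FdcA k) (δ : FdcP) : FdcA k := b - fdcIota k δ

omit [NeZero k] in
/-- `fdcCorner k b δ = b - ι δ` (definitional). [folklore] -/
theorem fdcCorner_apply (b : FdcA k) (δ : FdcP) : fdcCorner k b δ = b - fdcIota k δ := rfl

omit [NeZero k] in
/-- The corner map of a plaquette is injective (`k ≥ 3`). [folklore] -/
theorem fdcCorner_injective (hk : 3 ≤ k) (b : FdcA k) : Function.Injective (fdcCorner k b) :=
  fun _ _ h => fdcIota_injective hk (sub_right_injective h)

omit [NeZero k] in
/-- **Distinct corner clusters**: a corner cluster of plaquette `b + eᵢ` is a corner cluster of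
plaquette `b` only in the forced way (`k ≥ 3`). [folklore] -/
theorem fdcCorner_eq_iff (hk : 3 ≤ k) (b : FdcA k) (i : Fin 2) (δ' δ'' : FdcP) :
    fdcCorner k (b + Pi.single i 1) δ'' = fdcCorner k b δ' ↔ δ' i = 0 ∧ δ'' = δ' + Pi.single i 1 := by
  simp only [fdcCorner]
  constructor
  · intro h
    apply fdcIota_eq_add_single hk
    have h2 : b + Pi.single i 1 - fdcIota k δ'' + fdcIota k δ'' + fdcIota k δ' =
        b - fdcIota k δ' + fdcIota k δ'' + fdcIota k δ' := by rw [h]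
    simp only [sub_add_cancel] at h2
    have h3 : fdcIota k δ'' = b + Pi.single i 1 + fdcIota k δ' - b := by
      rw [h2]; abel
    rw [h3]; abel
  · rintro ⟨h0, rfl⟩
    rw [fdcIota_add_single δ' i h0]
    abel

omit [NeZero k] in
/-- The corners `δ''` of `b + eᵢ` with `δ''_i ≠ 0` are the corners `δ'' + eᵢ` of `b`. [folklore] -/
theorem fdcCorner_add_single_of_ne (b : FdcA k) (i : Fin 2) (δ'' : FdcP) (h : δ'' i ≠ 0) :
    fdcCorner k (b + Pi.single i 1) δ'' = fdcCorner k b (δ'' + Pi.single i 1) := by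
  simp only [fdcCorner]
  rw [← fdcIota_add_single_of_ne δ'' i h]
  abel

omit [NeZero k] in
/-- A corner `δ''` of `b + eᵢ` with `δ''_i = 0` is not a corner cluster of `b` (`k ≥ 3`). [folklore] -/
theorem fdcCorner_ne_of_eq_zero (hk : 3 ≤ k) (b : FdcA k) (i : Fin 2) (δ' δ'' : FdcP)
    (h : δ'' i = 0) : fdcCorner k b δ' ≠ fdcCorner k (b + Pi.single i 1) δ'' := by
  intro h'
  obtain ⟨h0, rfl⟩ := (fdcCorner_eq_iff hk b i δ' δ'').1 h'.symm
  rw [Pi.add_apply, Pi.single_eq_same, h0, zero_add] at h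
  exact one_ne_zero h

/-! ### Bond classification -/

/-- Positions step: the position of `x + eᵢ` is `δ + eᵢ`. [folklore] -/
theorem fdcEA_snd_add_single (hkL : k * 2 = L) (x : TorusSite 2 L) (i : Fin 2) :
    (fdcEA hkL (x + Pi.single i 1)).2 = (fdcEA hkL x).2 + Pi.single i 1 :=
  boxBlockDecomp_snd_add_single (cvec_mul hkL) x i

/-- **A-bond** (`δ_i = 0`): `x + eᵢ` lies in the same cluster. [folklore] -/
theorem fdcEA_fst_add_single_of_eq_zero (hkL : k * 2 = L) (x : TorusSite 2 L) (i : Fin 2)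
    (h : (fdcEA hkL x).2 i = 0) : (fdcEA hkL (x + Pi.single i 1)).1 = (fdcEA hkL x).1 :=
  boxBlockDecomp_fst_add_single_of_lt (cvec_mul hkL) x i (by
    show ((fdcEA hkL x).2 i).val + 1 < 2
    rw [h, ZMod.val_zero]; norm_num)

/-- **B-bond** (`δ_i ≠ 0`): `x + eᵢ` lies in the next cluster. [folklore] -/
theorem fdcEA_fst_add_single_of_ne_zero (hkL : k * 2 = L) (x : TorusSite 2 L) (i : Fin 2)
    (h : (fdcEA hkL x).2 i ≠ 0) :
    (fdcEA hkL (x + Pi.single i 1)).1 = (fdcEA hkL x).1 + Pi.single i 1 :=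
  boxBlockDecomp_fst_add_single_of_eq (cvec_mul hkL) x i (by
    rcases zmod2_eq_zero_or_one ((fdcEA hkL x).2 i) with h' | h'
    · exact absurd h' h
    · have hv : ((fdcEA hkL x).2 i).val = 1 := by rw [h']; exact zmod2_val_one
      show ((fdcEA hkL x).2 i).val + 1 = 2
      omega)

/-- **A-bond plaquettes**: for `δ_i = 0` the partner `x + eᵢ` lies in plaquette `b + eᵢ` at position
`δ + eᵢ`, where `(b, δ) = fdcEB x`. [folklore] -/
theorem fdcEB_add_single_of_eq_zero (hkL : k * 2 = L) (x : TorusSite 2 L) (i : Fin 2)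
    (h : (fdcEA hkL x).2 i = 0) :
    fdcEB hkL (x + Pi.single i 1) =
      ((fdcEB hkL x).1 + Pi.single i 1, (fdcEA hkL x).2 + Pi.single i 1) := by
  rw [fdcEB_apply, fdcEB_apply, fdcEA_snd_add_single, fdcEA_fst_add_single_of_eq_zero hkL x i h,
    fdcIota_add_single _ i h]
  refine Prod.ext ?_ rfl
  simp only
  abel

/-- **B-bond plaquette**: for `δ_i ≠ 0` the partner `x + eᵢ` lies in the SAME plaquette `b` at
position `δ + eᵢ`. [folklore] -/
theorem fdcEB_add_single_of_ne_zero (hkL : k * 2 = L) (x : TorusSite 2 L) (i : Fin 2)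
    (h : (fdcEA hkL x).2 i ≠ 0) :
    fdcEB hkL (x + Pi.single i 1) = ((fdcEB hkL x).1, (fdcEA hkL x).2 + Pi.single i 1) := by
  rw [fdcEB_apply, fdcEB_apply, fdcEA_snd_add_single, fdcEA_fst_add_single_of_ne_zero hkL x i h]
  refine Prod.ext ?_ rfl
  simp only
  rw [← fdcIota_add_single_of_ne _ i h]
  abel

/-- Number of clusters: `|A| = k²`. [folklore] -/
theorem card_fdcA : Fintype.card (FdcA k) = k ^ 2 := by
  rw [card_rectTorusSite_eq_prod, Fin.prod_const]

end Geometry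

/-! ### Conjugation by the plaquette-product unitary -/

section Conjugation

variable {Λ B F : Type*} [Fintype Λ] [DecidableEq Λ] [Fintype B] [DecidableEq B]
  [Fintype F] [DecidableEq F] {q : ℕ}

/-- `U† · (Y at block b) · U = (u† Y u at block b)` for `U = ⨂_b u`, `u† u = 1`. [folklore] -/
theorem conj_blockProductOp_update (e : Λ ≃ B × F) {u : Op F q} (hu : uᴴ * u = 1) (b : B)
    (Y : Op F q) :
    (blockProductOp e fun _ => u)ᴴ * blockProductOp e (Function.update (fun _ => (1 : Op F q)) b Y) *
        blockProductOp e (fun _ => u) =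
      blockProductOp e (Function.update (fun _ => (1 : Op F q)) b (uᴴ * Y * u)) := by
  rw [blockProductOp_conjTranspose, blockProductOp_mul, blockProductOp_mul]
  congr 1
  funext b'
  by_cases hb : b' = b
  · subst hb
    simp only [Function.update_self]
  · simp only [Function.update_of_ne hb, mul_one, hu]

/-- **Light cone of one site**: `U† (onSite x s) U = spinEmbed_b (u† (onSite f s) u)` where
`e x = (b, f)`. [folklore] -/
theorem conj_onSite_blockProductOp (e : Λ ≃ B × F) {u : Op F q} (hu : uᴴ * u = 1) {x : Λ} {b : B}
    {f : F} (hx : e x = (b, f)) (s : Matrix (Fin q) (Fin q) ℂ) :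
    (blockProductOp e fun _ => u)ᴴ * onSite x s * blockProductOp e (fun _ => u) =
      spinEmbed (blockEmb e b) (uᴴ * onSite f s * u) := by
  rw [onSite_eq_blockProductOp e hx, conj_blockProductOp_update e hu,
    blockProductOp_update_eq_spinEmbed]

/-- `U† (O₁ O₂) U = (U† O₁ U)(U† O₂ U)` for unitary `U`. [folklore] -/
theorem conj_mul_of_mul_conjTranspose_eq_one {m : Type*} [Fintype m] [DecidableEq m]
    {U : Matrix m m ℂ} (hU : U * Uᴴ = 1) (O₁ O₂ : Matrix m m ℂ) :
    Uᴴ * (O₁ * O₂) * U = Uᴴ * O₁ * U * (Uᴴ * O₂ * U) := by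
  calc Uᴴ * (O₁ * O₂) * U = Uᴴ * O₁ * (U * Uᴴ) * O₂ * U := by rw [hU]; noncomm_ring
    _ = Uᴴ * O₁ * U * (Uᴴ * O₂ * U) := by noncomm_ring

/-- The plaquette product `U = ⨂_b u` of a unitary is unitary: `U U† = 1`. [folklore] -/
theorem blockProductOp_mul_conjTranspose_self (e : Λ ≃ B × F) {u : Op F q} (hu : uᴴ * u = 1) :
    blockProductOp e (fun _ => u) * (blockProductOp e fun _ => u)ᴴ = 1 :=
  mul_eq_one_comm.1 (conjTranspose_blockProductOp_mul_self e fun _ => hu)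

/-- **Expectations in `U Ψ₀`**: `⟨U Ψ₀, O U Ψ₀⟩ = ⟨Ψ₀, (U† O U) Ψ₀⟩`. [folklore] -/
theorem expect_mulVec_conj {m : Type*} [Fintype m] (U O : Matrix m m ℂ) (Ψ₀ : m → ℂ) :
    star (U *ᵥ Ψ₀) ⬝ᵥ (O *ᵥ (U *ᵥ Ψ₀)) = star Ψ₀ ⬝ᵥ ((Uᴴ * O * U) *ᵥ Ψ₀) := by
  rw [star_mulVec, ← dotProduct_mulVec, ← mulVec_mulVec, ← mulVec_mulVec]

/-- Norm of `U Ψ₀` for unitary `U`: `⟨U Ψ₀, U Ψ₀⟩ = ⟨Ψ₀, Ψ₀⟩`. [folklore] -/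
theorem star_mulVec_dotProduct_mulVec_of_unitary {m : Type*} [Fintype m] [DecidableEq m]
    {U : Matrix m m ℂ}
    (hU : Uᴴ * U = 1) (Ψ₀ : m → ℂ) : star (U *ᵥ Ψ₀) ⬝ᵥ (U *ᵥ Ψ₀) = star Ψ₀ ⬝ᵥ Ψ₀ := by
  rw [star_mulVec, ← dotProduct_mulVec, mulVec_mulVec, hU, one_mulVec]

/-- The norm of a product state over a constant family: `⟨⨂φ, ⨂φ⟩ = ⟨φ, φ⟩^{|B|}`. [folklore] -/
theorem star_blockProductStates_const_dotProduct_self (e : Λ ≃ B × F)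
    (φ : TensorIndex F q → ℂ) :
    star (blockProductStates e fun _ => φ) ⬝ᵥ blockProductStates e (fun _ => φ) =
      (star φ ⬝ᵥ φ) ^ Fintype.card B := by
  rw [star_blockProductStates_dotProduct, prod_const, card_univ]

end Conjugation

end

end Summit.HubbardSuperconductivity.HubbardLadder.Bounds
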